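import Summits.PneNP.PneNP.Theorems.ChebyshevTracialDesignProfileExtrapolation
import HarnessLib

/-!
# Cell pnp-psdrank, route `ChebyshevTracialDesign`: the LAYER-RESOLVED TIGHTNESS IDENTITY — the skeleton of spectral non-tightness (SNT)
# into which the level-k inequalities (F1)/(F2) plug

Harmonic backbone of the crux `TracialDecayExp20` (stmt-PneNP-19878), brick 25 (prover g7). Planner p1's SNT lemma (HOME/pnp-psdrank-p1/
N2-SpreadStructure.md §SNT (1)) — "a dense X times a τ-homogeneous Y is never tight at the exp scale" — is the expansion
`0 = ⟨1_X, K_1 1_Y⟩ = μν + Σ_{k≥2} γ_k` followed by level-k inequalities on both sides. This file puts the EXPANSION in the kernel, for the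
tight incidence `A_1(U,M) = 1[cc(U,M) = 1]` on (`t`-subsets) × (perfect matchings): with the layer correlations
`T_j(X,Y) := Σ_{M∈Y} Σ_{|U|=t} ((Wᵀ)^{t−j}p_j)(U)·A_1(U,M)` of a harmonic layer decomposition `p` of `1_X`,
* `tight_pairs_eq_sum_layerCorr` — `#{(U,M) ∈ X×Y : cc(U,M) = 1} = Σ_{j≤t} T_j(X,Y)`;
* `sum_ladderSum_eq_card`, `layerCorr_zero_eq` — `Σ_{|U|=t} 1_X = C(n,t)·t!·p_0(∅) = |X|` and `T_0(X,Y) = (|X|/C(n,t))·N_1·|Y|`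
  (`N_1 = T(n/2;1,c')` the number of tight `t`-cuts of a matching, `t = 2c'+1`);
* `tightFree_layer_identity` — **for a TIGHT-FREE rectangle: `(|X|/C(n,t))·N_1·|Y| + Σ_{1≤j≤t} T_j(X,Y) = 0`**;
* `abs_layerCorr_le` — the unconditional Cauchy–Schwarz/Parseval bound `|T_j(X,Y)| ≤ √(|Y| · kernelEigen n t j κ_1 · ⟪(Wᵀ)^{t−j}p_j,(Wᵀ)^{t−j}p_j⟫)`
  (with it the identity reproduces the σ₂ brick; SNT = the same identity with (F1), the slice level-k inequality for `X`, and (F2), Keevash–Lifshitz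
  for the pull-back of `Y` to `S_n`, in place of Cauchy–Schwarz on the head layers).
[cite: Rothvoss2017, §2 (PDF p. 6)] [cite: BrouwerHaemers2012, Prop. 4.3.2 (PDF p. 83)]
Stature: support/instrument (S4 skeleton of the r = 1 rung). WHAT THIS IS NOT: not SNT (no level-k inequality is proved here), nothing on psd
rank, no P-vs-NP content. Supports stmt-PneNP-19878.
-/

set_option linter.dupNamespace false -- `Summit.PneNP.PneNP.…`: summit = sub-problem (D-0017)

noncomputable section

namespace Summit.PneNP.PneNP.Theorems.ChebyshevTracialDesignTightFreeLayers

open Finset Literature.Barriers.PneNP Literature.Combinatorics.Optimization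
open Literature.Combinatorics.AssociationSchemes Literature.Combinatorics.AssociationSchemes.JohnsonHarmonics
open Literature.Combinatorics.AssociationSchemes.JohnsonSpectrum
open Summit.PneNP.PneNP.Theorems.ChebyshevTracialDesignTightFreeSpectral
open Summit.PneNP.PneNP.Theorems.ChebyshevTracialDesignLevelAttenuation
open Summit.PneNP.PneNP.Theorems.ChebyshevTracialDesignProfileExtrapolation

variable {n : ℕ}

/-! ### §1 The number of tight pairs of a rectangle, layer by layer -/

/-- **Tight pairs = sum of layer correlations**: for `X ⊆` `t`-subsets with harmonic layer decomposition `p` of its indicator and any `Y`,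
`#{(U,M) ∈ X × Y : #cr(U,M) = 1} = Σ_{j≤t} Σ_{M∈Y} Σ_{|U|=t} ((Wᵀ)^{t−j}p_j)(U)·1[#cr(U,M) = 1]`. [cite: Rothvoss2017, §2 (PDF p. 6)] -/
theorem tight_pairs_eq_sum_layerCorr {t : ℕ} (X : Finset (Finset (Fin n))) (hX : X ⊆ univ.powersetCard t) (Y : Finset (PMatch n))
    (p : ℕ → Finset (Fin n) → ℝ)
    (hdec : ∀ U ∈ univ.powersetCard t, (if U ∈ X then (1 : ℝ) else 0) = (∑ j ∈ range (t + 1), up^[t - j] (p j)) U) :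
    ((((X ×ˢ Y).filter fun UM : Finset (Fin n) × PMatch n =>
        (UM.1.filter fun x => UM.2.2.partner x ∉ UM.1).card = 1).card : ℕ) : ℝ) =
      ∑ j ∈ range (t + 1), ∑ M ∈ Y, ∑ U ∈ univ.powersetCard t,
        (up^[t - j] (p j)) U * (if (U.filter fun x => M.2.partner x ∉ U).card = 1 then (1 : ℝ) else 0) := by
  classical
  have hcount : ((((X ×ˢ Y).filter fun UM : Finset (Fin n) × PMatch n =>
        (UM.1.filter fun x => UM.2.2.partner x ∉ UM.1).card = 1).card : ℕ) : ℝ) =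
      ∑ M ∈ Y, ∑ U ∈ univ.powersetCard t,
        (if U ∈ X then (1 : ℝ) else 0) * (if (U.filter fun x => M.2.partner x ∉ U).card = 1 then (1 : ℝ) else 0) := by
    rw [card_filter, Nat.cast_sum, sum_product, sum_comm]
    push_cast
    refine sum_congr rfl fun M _ => ?_
    rw [sum_boole_mul_of_subset hX]
  rw [hcount]
  have hsub : ∀ M ∈ Y, ∑ U ∈ univ.powersetCard t,
      (if U ∈ X then (1 : ℝ) else 0) * (if (U.filter fun x => M.2.partner x ∉ U).card = 1 then (1 : ℝ) else 0) =
      ∑ j ∈ range (t + 1), ∑ U ∈ univ.powersetCard t,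
        (up^[t - j] (p j)) U * (if (U.filter fun x => M.2.partner x ∉ U).card = 1 then (1 : ℝ) else 0) := by
    intro M _
    rw [sum_comm]
    refine sum_congr rfl fun U hU => ?_
    rw [hdec U hU, Finset.sum_apply, sum_mul]
  rw [sum_congr rfl hsub, sum_comm]

/-! ### §2 The constant layer carries the density -/

/-- **The mass of the indicator sits in the constant layer**: `Σ_{|U|=t} 1_X(U) = C(n,t)·t!·p_0(∅) = |X|`, i.e.
`t!·p_0(∅) = |X|/C(n,t) = μ(X)`. [cite: BrouwerHaemers2012, Prop. 4.3.2 proof (α₁ = s/√n; PDF p. 83)] -/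
theorem factorial_mul_coeff_zero_eq {t : ℕ} (ht : t ≤ n) (X : Finset (Finset (Fin n))) (hX : X ⊆ univ.powersetCard t)
    (p : ℕ → Finset (Fin n) → ℝ) (hp : ∀ j, IsHarmonic j (p j))
    (hdec : ∀ U ∈ univ.powersetCard t, (if U ∈ X then (1 : ℝ) else 0) = (∑ j ∈ range (t + 1), up^[t - j] (p j)) U) :
    (t.factorial : ℝ) * (p 0) ∅ = (X.card : ℝ) / (n.choose t : ℝ) := by
  have hCn : (0 : ℝ) < n.choose t := by exact_mod_cast Nat.choose_pos ht
  -- `Σ_U 1_X = |X|` and `Σ_U (ladder sum) = Σ_j Σ_U (layer j) = Σ_U (layer 0) = C(n,t)·t!·p₀(∅)`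
  have hsum : ∑ U ∈ univ.powersetCard t, (∑ j ∈ range (t + 1), up^[t - j] (p j)) U = (X.card : ℝ) := by
    rw [← sum_boole_sq_of_subset hX]
    refine sum_congr rfl fun U hU => ?_
    rw [← hdec U hU]; split_ifs <;> simp
  have hlayers : ∑ U ∈ univ.powersetCard t, (∑ j ∈ range (t + 1), up^[t - j] (p j)) U =
      (n.choose t : ℝ) * ((t.factorial : ℝ) * (p 0) ∅) := by
    simp only [Finset.sum_apply]
    rw [sum_comm, sum_eq_single_of_mem 0 (mem_range.2 (by omega)) fun j hj hj0 => ?_]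
    · rw [Nat.sub_zero, sum_congr rfl fun U hU => iterate_up_apply_of_degree_zero (hp 0).1 (mem_powersetCard.1 hU).2,
        sum_const, card_powersetCard, card_univ, Fintype.card_fin, nsmul_eq_mul]
    · exact sum_powersetCard_ladder_eq_zero (by omega) (by have := mem_range.1 hj; omega) (hp j)
  rw [hlayers] at hsum
  field_simp
  linarith

/-- **The constant layer correlation**: `T_0(X,Y) = (|X|/C(n,t))·N_1·|Y|` with `N_1 = T(n/2; 1, c')` the number of tight `t`-cuts of a
perfect matching (`t = 2c'+1 ≤ n`). [cite: Rothvoss2017, §2 (PDF p. 6)] -/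
theorem layerCorr_zero_eq {c' : ℕ} (ht : 2 * c' + 1 ≤ n) (X : Finset (Finset (Fin n)))
    (hX : X ⊆ univ.powersetCard (2 * c' + 1)) (Y : Finset (PMatch n)) (p : ℕ → Finset (Fin n) → ℝ) (hp : ∀ j, IsHarmonic j (p j))
    (hdec : ∀ U ∈ univ.powersetCard (2 * c' + 1),
      (if U ∈ X then (1 : ℝ) else 0) = (∑ j ∈ range (2 * c' + 1 + 1), up^[2 * c' + 1 - j] (p j)) U) :
    ∑ M ∈ Y, ∑ U ∈ univ.powersetCard (2 * c' + 1),
        (up^[2 * c' + 1 - 0] (p 0)) U * (if (U.filter fun x => M.2.partner x ∉ U).card = 1 then (1 : ℝ) else 0) =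
      (X.card : ℝ) / (n.choose (2 * c' + 1) : ℝ) *
        ((((n / 2).choose (1 + c') * (1 + c').choose c' * 2 ^ 1 : ℕ) : ℝ) * Y.card) := by
  have hμ := factorial_mul_coeff_zero_eq ht X hX p hp hdec
  have hcol : ∀ M : PMatch n, ∑ U ∈ univ.powersetCard (2 * c' + 1),
      (if (U.filter fun x => M.2.partner x ∉ U).card = 1 then (1 : ℝ) else 0) =
      (((n / 2).choose (1 + c') * (1 + c').choose c' * 2 ^ 1 : ℕ) : ℝ) :=
    fun M => level_colSum_eq (r := 1) (e := c') ⟨0, rfl⟩ (by omega) M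
  have hterm : ∀ M ∈ Y, ∑ U ∈ univ.powersetCard (2 * c' + 1),
      (up^[2 * c' + 1 - 0] (p 0)) U * (if (U.filter fun x => M.2.partner x ∉ U).card = 1 then (1 : ℝ) else 0) =
      (X.card : ℝ) / (n.choose (2 * c' + 1) : ℝ) * (((n / 2).choose (1 + c') * (1 + c').choose c' * 2 ^ 1 : ℕ) : ℝ) := by
    intro M _
    rw [← hcol M, mul_sum]
    refine sum_congr rfl fun U hU => ?_
    rw [Nat.sub_zero, iterate_up_apply_of_degree_zero (hp 0).1 (mem_powersetCard.1 hU).2, hμ]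
  rw [sum_congr rfl hterm, sum_const, nsmul_eq_mul]
  ring

/-! ### §3 The identity for tight-free rectangles, and the unconditional bound on each layer -/

/-- **The layer-resolved tightness identity.** For `t = 2c'+1 ≤ n`, a family `X` of `t`-subsets with harmonic layer decomposition `p`
of its indicator and a set `Y` of perfect matchings such that NO pair `(U,M) ∈ X × Y` is tight (`#cr(U,M) ≠ 1`):
`(|X|/C(n,t))·N_1·|Y| + Σ_{1≤j≤t} T_j(X,Y) = 0`, `T_j(X,Y) = Σ_{M∈Y} Σ_{|U|=t} ((Wᵀ)^{t−j}p_j)(U)·1[#cr(U,M) = 1]`.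
[cite: Rothvoss2017, §2 (PDF p. 6)] [cite: BrouwerHaemers2012, Prop. 4.3.2 (PDF p. 83)] -/
theorem tightFree_layer_identity {c' : ℕ} (ht : 2 * c' + 1 ≤ n) (X : Finset (Finset (Fin n)))
    (hX : X ⊆ univ.powersetCard (2 * c' + 1)) (Y : Finset (PMatch n)) (p : ℕ → Finset (Fin n) → ℝ) (hp : ∀ j, IsHarmonic j (p j))
    (hdec : ∀ U ∈ univ.powersetCard (2 * c' + 1),
      (if U ∈ X then (1 : ℝ) else 0) = (∑ j ∈ range (2 * c' + 1 + 1), up^[2 * c' + 1 - j] (p j)) U)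
    (hXY : ∀ U ∈ X, ∀ M ∈ Y, (U.filter fun x => M.2.partner x ∉ U).card ≠ 1) :
    (X.card : ℝ) / (n.choose (2 * c' + 1) : ℝ) *
        ((((n / 2).choose (1 + c') * (1 + c').choose c' * 2 ^ 1 : ℕ) : ℝ) * Y.card) +
      ∑ j ∈ Ico 1 (2 * c' + 1 + 1), ∑ M ∈ Y, ∑ U ∈ univ.powersetCard (2 * c' + 1),
        (up^[2 * c' + 1 - j] (p j)) U * (if (U.filter fun x => M.2.partner x ∉ U).card = 1 then (1 : ℝ) else 0) = 0 := by
  classical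
  have htot := tight_pairs_eq_sum_layerCorr X hX Y p hdec
  -- no tight pairs
  have hzero : ((((X ×ˢ Y).filter fun UM : Finset (Fin n) × PMatch n =>
      (UM.1.filter fun x => UM.2.2.partner x ∉ UM.1).card = 1).card : ℕ) : ℝ) = 0 := by
    rw [Nat.cast_eq_zero, card_eq_zero, filter_eq_empty_iff]
    intro UM hUM
    obtain ⟨hU, hM⟩ := mem_product.1 hUM
    exact hXY UM.1 hU UM.2 hM
  rw [hzero, range_eq_Ico, ← Finset.sum_Ico_consecutive _ (Nat.zero_le 1) (by omega : 1 ≤ 2 * c' + 1 + 1),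
    show Ico 0 1 = {0} by rfl, sum_singleton, layerCorr_zero_eq ht X hX Y p hp hdec] at htot
  linarith

/-- **Each layer correlation is at most its Parseval size**: with `κ_1` the Gram class function of the tight incidence,
`|T_j(X,Y)| ≤ √(|Y| · kernelEigen n t j κ_1 · ⟪(Wᵀ)^{t−j}p_j, (Wᵀ)^{t−j}p_j⟫)` (Cauchy–Schwarz over `Y`, then
`‖A_1ᵀ (Wᵀ)^{t−j}p_j‖² = kernelEigen·⟪·,·⟫`). [cite: BrouwerHaemers2012, Prop. 4.3.2 (PDF p. 83)] -/
theorem abs_layerCorr_le {t j : ℕ} (hjt : j ≤ t) (Y : Finset (PMatch n)) (p : ℕ → Finset (Fin n) → ℝ)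
    (hp : ∀ j, IsHarmonic j (p j)) (κ₁ : ℕ → ℝ)
    (hA1 : ∀ U ∈ univ.powersetCard t, ∀ U' ∈ univ.powersetCard t,
      ∑ M : PMatch n, (if (U.filter fun x => M.2.partner x ∉ U).card = 1 then (1 : ℝ) else 0) *
        (if (U'.filter fun x => M.2.partner x ∉ U').card = 1 then (1 : ℝ) else 0) = κ₁ (U ∩ U').card) :
    |∑ M ∈ Y, ∑ U ∈ univ.powersetCard t,
        (up^[t - j] (p j)) U * (if (U.filter fun x => M.2.partner x ∉ U).card = 1 then (1 : ℝ) else 0)| ≤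
      Real.sqrt ((Y.card : ℝ) * (kernelEigen n t j κ₁ * ip (up^[t - j] (p j)) (up^[t - j] (p j)))) := by
  classical
  set h : PMatch n → ℝ := fun M => ∑ U ∈ univ.powersetCard t,
    (up^[t - j] (p j)) U * (if (U.filter fun x => M.2.partner x ∉ U).card = 1 then (1 : ℝ) else 0) with hh
  refine Real.abs_le_sqrt ?_
  have hCS := sum_mul_sq_le_sq_mul_sq Y (fun _ => (1 : ℝ)) h
  simp only [one_mul, one_pow, sum_const, nsmul_eq_mul, mul_one] at hCS
  have hgram := sum_sq_gram_ladder hjt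
    (fun U (M : PMatch n) => if (U.filter fun x => M.2.partner x ∉ U).card = 1 then (1 : ℝ) else 0) κ₁ hA1 (hp j)
  have hsub : ∑ M ∈ Y, h M ^ 2 ≤ ∑ M : PMatch n, h M ^ 2 := sum_le_univ_sum_of_nonneg fun M => sq_nonneg _
  calc (∑ M ∈ Y, h M) ^ 2 ≤ (Y.card : ℝ) * ∑ M ∈ Y, h M ^ 2 := hCS
    _ ≤ (Y.card : ℝ) * ∑ M : PMatch n, h M ^ 2 := mul_le_mul_of_nonneg_left hsub (Nat.cast_nonneg _)
    _ = (Y.card : ℝ) * (kernelEigen n t j κ₁ * ip (up^[t - j] (p j)) (up^[t - j] (p j))) := by rw [hh, hgram]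

end Summit.PneNP.PneNP.Theorems.ChebyshevTracialDesignTightFreeLayers
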